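import Summits.CriticalPhenomena.SAWScalingLimit.Theorems.SAWTotalPositivityBoundaryTP2Defs
import Summits.CriticalPhenomena.SAWScalingLimit.Theorems.SAWTotalPositivityBoundaryTP2Kernel
import Summits.CriticalPhenomena.SAWScalingLimit.Theorems.SAWTotalPositivityBoundaryTP2Symmetry
import Summits.CriticalPhenomena.SAWScalingLimit.Theorems.SAWTotalPositivityBoundaryTP2RectReflect
import Summits.CriticalPhenomena.SAWScalingLimit.Theorems.SAWTotalPositivityBoundaryTP2LadderBottomRowAdjacent
import Summits.CriticalPhenomena.SAWScalingLimit.Theorems.SAWTotalPositivityBoundaryTP2LadderBottomRowNested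
import Summits.CriticalPhenomena.SAWScalingLimit.Theorems.SAWTotalPositivityBoundaryTP2LadderCcwBbbt
import Summits.CriticalPhenomena.SAWScalingLimit.Theorems.SAWTotalPositivityBoundaryTP2LadderCcwBbttAdjacent
import Summits.CriticalPhenomena.SAWScalingLimit.Theorems.SAWTotalPositivityBoundaryTP2LadderCcwBbttNested
import Summits.CriticalPhenomena.SAWScalingLimit.Theorems.SAWTotalPositivityBoundaryTP2LadderCcwTttt
import Summits.CriticalPhenomena.SAWScalingLimit.Theorems.EdgeOfPositivity.Negative.EdgeOfPositivityRectDomain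
import HarnessLib

/-!
# Crux `BoundaryTP2` (stmt-CriticalPhenomena-7115): every counter-clockwise quadruple of every ladder

Line `Sketch`, lead c5 (final assembly, part 1).  On the ladder `{0,…,L} × {0,1}` index the boundary cycle
counter-clockwise by the position `c` of the bottom site `(c,0)` and `2L+1-c` of the top site `(c,1)`.  For every four
sites `q₁,q₂,q₃,q₄` of the ladder with strictly increasing positions and every `0 ≤ x ≤ 1/2`, BOTH non-crossing
pairings outweigh the crossing one:

* `N1`: `Z(q₁,q₃)·Z(q₂,q₄) ≤ Z(q₁,q₂)·Z(q₃,q₄)`,   `N2`: `Z(q₁,q₃)·Z(q₂,q₄) ≤ Z(q₁,q₄)·Z(q₂,q₃)`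

(`ladder_ccw_general`).  Increasing positions force the row pattern `b^k t^{4-k}` (bottom sites first, with
increasing columns; then top sites with decreasing columns); the five patterns are dispatched to the landed row-type
lemmas `stub_ladder_bottomRow_adjacent/_nested` (`bbbb`), `ladder_ccw_bbbt`, `ladder_ccw_bbtt_adjacent/_nested`,
`ladder_ccw_bttt` (here, the row reflection of `ladder_ccw_bbbt`) and `ladder_ccw_tttt`, which in turn rest on the
26 ladder inequalities of cycle c5 (exact kernels; rank-two Cauchy–Binet with signed orientation determinants for the
column-separated minors; ratio and almost-Cauchy–Binet bounds for the others).
-/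

noncomputable section

namespace Summit.CriticalPhenomena.SAWScalingLimit.Theorems.BoundaryTP2

open Literature.Probability.LatticeModels Literature.Probability.RandomPlanarGeometry
open Summit.CriticalPhenomena.SAWScalingLimit.Theorems.EdgeOfPositivity.Negative
open scoped ENNReal

/-- Row reflection of a ladder kernel: `Z((i,j),(i',j')) = Z((i,1-j),(i',1-j'))`. [folklore] -/
private theorem ccw_rowReflect (L : ℕ) (x : ℝ) (i j i' j' : ℤ) :
    pathKernel (discreteDomainGraph (rectDomain L 1) 1) x (st i j) (st i' j') =
      pathKernel (discreteDomainGraph (rectDomain L 1) 1) x (st i (1 - j)) (st i' (1 - j')) := by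
  simpa using (stub_rect_reflect L 1 x i j i' j').2

/-- **One bottom site and three top sites** (counter-clockwise `(c,0),(d₂,1),(d₃,1),(d₄,1)`, `d₄ < d₃ < d₂ ≤ L`,
`c ≤ L`), `0 ≤ x ≤ 1/2`: both non-crossing pairings beat the crossing one — the row reflection of `ladder_ccw_bbbt`.
[folklore] -/
theorem ladder_ccw_bttt (L : ℕ) {c d₂ d₃ d₄ : ℕ} (h₄₃ : d₄ < d₃) (h₃₂ : d₃ < d₂) (h₂ : d₂ ≤ L) (hc : c ≤ L)
    {x : ℝ} (hx0 : 0 ≤ x) (hx : x ≤ 1 / 2) :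
    (pathKernel (discreteDomainGraph (rectDomain L 1) 1) x (st c 0) (st d₃ 1) *
        pathKernel (discreteDomainGraph (rectDomain L 1) 1) x (st d₂ 1) (st d₄ 1) ≤
      pathKernel (discreteDomainGraph (rectDomain L 1) 1) x (st c 0) (st d₂ 1) *
        pathKernel (discreteDomainGraph (rectDomain L 1) 1) x (st d₃ 1) (st d₄ 1)) ∧
    (pathKernel (discreteDomainGraph (rectDomain L 1) 1) x (st c 0) (st d₃ 1) *
        pathKernel (discreteDomainGraph (rectDomain L 1) 1) x (st d₂ 1) (st d₄ 1) ≤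
      pathKernel (discreteDomainGraph (rectDomain L 1) 1) x (st c 0) (st d₄ 1) *
        pathKernel (discreteDomainGraph (rectDomain L 1) 1) x (st d₂ 1) (st d₃ 1)) := by
  set R := discreteDomainGraph (rectDomain L 1) 1 with hR
  obtain ⟨h1, h2⟩ := ladder_ccw_bbbt L h₄₃ h₃₂ h₂ hc hx0 hx
  -- move every kernel of `h1`, `h2` to the reflected rows
  have e : ∀ (i i' : ℤ) (j j' : ℤ), pathKernel R x (st i j) (st i' j') =
      pathKernel R x (st i (1 - j)) (st i' (1 - j')) := fun i i' j j' => ccw_rowReflect L x i j i' j'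
  have k13 : pathKernel R x (st c 0) (st d₃ 1) = pathKernel R x (st d₃ 0) (st c 1) := by
    rw [pathKernel_comm, e]; norm_num
  have k24 : pathKernel R x (st d₂ 1) (st d₄ 1) = pathKernel R x (st d₄ 0) (st d₂ 0) := by
    rw [pathKernel_comm, e]; norm_num
  have k12 : pathKernel R x (st c 0) (st d₂ 1) = pathKernel R x (st d₂ 0) (st c 1) := by
    rw [pathKernel_comm, e]; norm_num
  have k34 : pathKernel R x (st d₃ 1) (st d₄ 1) = pathKernel R x (st d₄ 0) (st d₃ 0) := by
    rw [pathKernel_comm, e]; norm_num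
  have k14 : pathKernel R x (st c 0) (st d₄ 1) = pathKernel R x (st d₄ 0) (st c 1) := by
    rw [pathKernel_comm, e]; norm_num
  have k23 : pathKernel R x (st d₂ 1) (st d₃ 1) = pathKernel R x (st d₃ 0) (st d₂ 0) := by
    rw [pathKernel_comm, e]; norm_num
  constructor
  · rw [k13, k24, k12, k34]
    calc pathKernel R x (st d₃ 0) (st c 1) * pathKernel R x (st d₄ 0) (st d₂ 0)
        = pathKernel R x (st d₄ 0) (st d₂ 0) * pathKernel R x (st d₃ 0) (st c 1) := mul_comm _ _
      _ ≤ pathKernel R x (st d₄ 0) (st d₃ 0) * pathKernel R x (st d₂ 0) (st c 1) := h1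
      _ = pathKernel R x (st d₂ 0) (st c 1) * pathKernel R x (st d₄ 0) (st d₃ 0) := mul_comm _ _
  · rw [k13, k24, k14, k23]
    calc pathKernel R x (st d₃ 0) (st c 1) * pathKernel R x (st d₄ 0) (st d₂ 0)
        = pathKernel R x (st d₄ 0) (st d₂ 0) * pathKernel R x (st d₃ 0) (st c 1) := mul_comm _ _
      _ ≤ pathKernel R x (st d₄ 0) (st c 1) * pathKernel R x (st d₃ 0) (st d₂ 0) := h2

/-- A site of the ladder is `(c,0)` or `(c,1)` for a column `c ≤ L`. [folklore] -/
theorem ladder_site_cases {L : ℕ} {q : Site 2} (hq : q ∈ rectSites L 1) :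
    ∃ c : ℕ, c ≤ L ∧ (q = st c 0 ∨ q = st c 1) := by
  rw [mem_rectSites_iff] at hq
  obtain ⟨⟨h0, hL⟩, h1, h1'⟩ := hq
  refine ⟨(q 0).toNat, by omega, ?_⟩
  have hc : ((q 0).toNat : ℤ) = q 0 := Int.toNat_of_nonneg h0
  rcases (show q 1 = 0 ∨ q 1 = 1 by omega) with h | h
  · left
    calc q = st (q 0) (q 1) := (st_eta q).symm
      _ = st ((q 0).toNat : ℤ) 0 := by rw [hc, h]
  · right
    calc q = st (q 0) (q 1) := (st_eta q).symm
      _ = st ((q 0).toNat : ℤ) 1 := by rw [hc, h]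

/-- **Every counter-clockwise quadruple of every ladder.** For sites `q₁,q₂,q₃,q₄` of the ladder `{0..L}×{0,1}` with
strictly increasing counter-clockwise positions (`c` for `(c,0)`, `2L+1-c` for `(c,1)`) and `0 ≤ x ≤ 1/2`, both
non-crossing pairings outweigh the crossing one. [folklore] -/
theorem ladder_ccw_general (L : ℕ) {q₁ q₂ q₃ q₄ : Site 2}
    (hq₁ : q₁ ∈ rectSites L 1) (hq₂ : q₂ ∈ rectSites L 1) (hq₃ : q₃ ∈ rectSites L 1) (hq₄ : q₄ ∈ rectSites L 1)
    (h12 : (if q₁ 1 = 0 then q₁ 0 else 2 * L + 1 - q₁ 0) < (if q₂ 1 = 0 then q₂ 0 else 2 * L + 1 - q₂ 0))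
    (h23 : (if q₂ 1 = 0 then q₂ 0 else 2 * L + 1 - q₂ 0) < (if q₃ 1 = 0 then q₃ 0 else 2 * L + 1 - q₃ 0))
    (h34 : (if q₃ 1 = 0 then q₃ 0 else 2 * L + 1 - q₃ 0) < (if q₄ 1 = 0 then q₄ 0 else 2 * L + 1 - q₄ 0))
    {x : ℝ} (hx0 : 0 ≤ x) (hx : x ≤ 1 / 2) :
    (pathKernel (discreteDomainGraph (rectDomain L 1) 1) x q₁ q₃ *
        pathKernel (discreteDomainGraph (rectDomain L 1) 1) x q₂ q₄ ≤
      pathKernel (discreteDomainGraph (rectDomain L 1) 1) x q₁ q₂ *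
        pathKernel (discreteDomainGraph (rectDomain L 1) 1) x q₃ q₄) ∧
    (pathKernel (discreteDomainGraph (rectDomain L 1) 1) x q₁ q₃ *
        pathKernel (discreteDomainGraph (rectDomain L 1) 1) x q₂ q₄ ≤
      pathKernel (discreteDomainGraph (rectDomain L 1) 1) x q₁ q₄ *
        pathKernel (discreteDomainGraph (rectDomain L 1) 1) x q₂ q₃) := by
  obtain ⟨c₁, hc₁, rfl | rfl⟩ := ladder_site_cases hq₁ <;>
  obtain ⟨c₂, hc₂, rfl | rfl⟩ := ladder_site_cases hq₂ <;>
  obtain ⟨c₃, hc₃, rfl | rfl⟩ := ladder_site_cases hq₃ <;>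
  obtain ⟨c₄, hc₄, rfl | rfl⟩ := ladder_site_cases hq₄ <;>
  simp only [st_zero, st_one, if_true, one_ne_zero, if_false] at h12 h23 h34
  -- bbbb
  · exact ⟨stub_ladder_bottomRow_adjacent L (by omega) (by omega) (by omega) hc₄ hx0 hx,
      stub_ladder_bottomRow_nested L (by omega) (by omega) (by omega) hc₄ hx0 hx⟩
  -- bbbt
  · exact ladder_ccw_bbbt L (by omega) (by omega) hc₃ hc₄ hx0 hx
  -- bbtb : impossible
  · omega
  -- bbtt
  · exact ⟨ladder_ccw_bbtt_adjacent L (by omega) hc₂ (by omega) hc₃ hx0 hx,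
      ladder_ccw_bbtt_nested L (by omega) hc₂ (by omega) hc₃ hx0 hx⟩
  -- btbb, btbt, bttb : impossible
  · omega
  · omega
  · omega
  -- bttt
  · exact ladder_ccw_bttt L (by omega) (by omega) hc₂ hc₁ hx0 hx
  -- t b _ _ : impossible (8 cases)
  · omega
  · omega
  · omega
  · omega
  · omega
  · omega
  · omega
  -- tttt
  · exact ladder_ccw_tttt L (by omega) (by omega) (by omega) hc₁ hx0 hx

end Summit.CriticalPhenomena.SAWScalingLimit.Theorems.BoundaryTP2
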